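import Summits.HodgeConjecture.HodgeCM.PerL34.GenuineSchrodingerTensor_1

/-! PORT of `HodgeCM/PerL34/GenuineSchrodingerTensor.lean` (HodgeCMPerL run 81) — part 2: continuation of `Summits.HodgeConjecture.HodgeCM.PerL34.GenuineSchrodingerTensor_1` (split at a top-level declaration boundary by port_pkg.py; scope re-opened below; declarations unchanged). -/

-- port_pkg: scope re-opened for this part (file-level context, then the namespace/section stack open at the cut)
set_option autoImplicit false
noncomputable section
open MeasureTheory MeasureTheory.Measure Set Metric Function Complex ComplexConjugate Topology Filter
open scoped RestrictedProduct InnerProductSpace NNReal ENNReal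
namespace HodgeCM.PerL34.PureTensor.SchrodingerModel
open HodgeCM.PerL34.LocalFactors HodgeCM.PerL34.LocalFactors.DilationModel
open HodgeCM.PerL34.IdelePlaces HodgeCM.PerL34.IdelicTorusModel HodgeCM.PerL34.IdelicTorusModel.Genuine
open HodgeCM.PerL34.RestrictedTensor HodgeCM.PerL34.RestrictedTensor.ProdL2 NumberField IsDedekindDomain
attribute [local instance] LocalFactors.DilationModel.Adic.nontriviallyNormedField
  LocalFactors.DilationModel.Adic.properSpace
variable {L : Type} [Field L] [NumberField L] [IsCMField L]
local notation3 "L⁺" => maximalRealSubfield L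
variable [∀ v : HeightOneSpectrum (𝓞 (maximalRealSubfield L)), MeasurableSpace (v.adicCompletion (maximalRealSubfield L))]
  [∀ v : HeightOneSpectrum (𝓞 (maximalRealSubfield L)), BorelSpace (v.adicCompletion (maximalRealSubfield L))]
section Equivariance
/-- **matrix coefficients of pure tensors FACTORISE over the split places**:
`⟪ω(k) tensorIso(⊗ f_v), tensorIso(⊗ f'_v)⟫_{L²(X)} = ∏_{v ∈ T} ⟪ω_v(k_v) f_v, f'_v⟫_{L²((L⁺_v)³)}` for any
finite `T` outside which `f_v = f'_v = 1_{𝒪_v³}` and `k_v` is a norm-one unit (the factors off `T` are `1`). -/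
theorem inner_rep_tensorIso_tp (k : Model L) (x x' : RVec (locFam L)) (T : Finset (SplitIdx L))
    (hx : ∀ i ∉ T, x i = ballIndicator (mloc L i) 0 1) (hx' : ∀ i ∉ T, x' i = ballIndicator (mloc L i) 0 1)
    (hk : ∀ j ∉ T, ‖((unitAt k j : ((basePlaceOf L j.1).adicCompletion L⁺)ˣ) : (basePlaceOf L j.1).adicCompletion L⁺)‖ = 1) :
    ⟪rep L 1 k (tensorIso L (tp (locFam L) x)), tensorIso L (tp (locFam L) x')⟫_ℂ
      = ∏ i ∈ T, ⟪dilationRep (mloc L i) (1 : ((basePlaceOf L i.1).adicCompletion L⁺)ˣ →* Circle)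
          (unitAt k i) (x i), x' i⟫_ℂ := by
  rw [rep_tensorIso, LinearIsometry.inner_map_map, repTensor_tp, inner_tp_tp]
  refine kfun_eq_prod (fun i hi => ?_) (fun i hi => ?_)
  · by_contra hiT
    refine hi ?_
    rw [gact_splitPart_apply, hx i hiT]
    exact dilationRep_ballIndicator_zero (mloc L i) 1 _ (hk i hiT) rfl 1
  · by_contra hiT
    exact hi (hx' i hiT)

end Equivariance

end HodgeCM.PerL34.PureTensor.SchrodingerModel

end
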